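import Literature.MathematicalPhysics.QuantumFieldTheory.Balaban1983to89.B15Prop1JointHolomorphyFromMinimiserFamily
import Literature.MathematicalPhysics.QuantumFieldTheory.Balaban1983to89.B15Prop1ValueOfAnyMinimiserB
import Literature.MathematicalPhysics.QuantumFieldTheory.Balaban1983to89.B15DeterminingSetsBAtDatum

/-!
# `Balaban1983to89.B15Prop1JointHolomorphyFromMinimiserFamilyB` — [Balaban1989LargeFieldI] (= [B15]) Prop. 1 p. 194 (last clause), (1.74) p. 192, (1.77) p. 194; [Balaban1989LargeFieldII]
# p. 359; [Balaban1985Variational] (= [15]) Prop. 9 (190) p. 309; [Balaban1988Convergent] (= [III]) (2.12) p. 256; [Balaban1984PropagatorsII] (= [II]) (2.3) p. 224: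
# (J1) ⇐ (J0′) — THE JOINT HOLOMORPHIC EXTENSION OF PRINT'S FUNCTION (1.77) FROM A HOLOMORPHIC FAMILY OF (2.12) MINIMISERS **OVER A BOND-LEVEL DATUM** — the print-datum edition of
# dag-n12-w1's `B15Prop1JointHolomorphyFromMinimiserFamily` §1–§2 (THEOREMS ONLY)

statement-level skeleton of published theorems with citation tags; proofs where landed; nothing here is a claim about
the Yang–Mills mass gap

Cell `pub-ymgap` (HUMAN RULINGS D-0062 ∕ D-0149), lane `pub-ymgap-dag-n12-c` g35 (R134 seat (a), N12 = [B15], s1); `--kind proof --supports` K1⁹ `stmt-QuantumFields-27364`;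
count-neutral.  THEOREMS ONLY (0 `def`, 0 `instance`, 0 `sorry`).  (E1) variant (iii-b), class (β) of the lane's census-by-declaration (bus [DAGN12C-G35], 2026-08-30): the two
declarations of the parent that N12's junction of record v14ᴸ (#10983) uses — `jointHolomorphic_fun177std_bgOfRecord_of_minimiserFamily` (§1) and
`jointHolomorphic_fun177std_bgMSCoPOfRecord_of_minimiserFamily` (§2) — re-keyed from reading (b)'s `(IsMinimizer … (Bj M₁ Z k), fun177std (Node00.bgOfRecord …))` to print's [II] (2.3)
currency `(IsMinimizerB … (bd k (maxDomT M₁ Z)), fun177stdB (Node00.bgOfRecordB …) M₁ bd)`.  The parent's §3 endpoint is NOT used by v14ᴸ (superseded by the at-length editions) and is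
not twinned.  FIRST USE OF THE LANE's CARRIER `DetBackgroundB.atDatum` (`B15DeterminingSetsBAtDatum`): dag-n12-c's ABSTRACT-background lemma
`B15Prop1JointHolomorphyFromBackground.jointHolomorphic_fun177std_of_valueMatched (bg : DetBackground …)` is applied AT THE CARRIER `(Node00.bgOfRecordB av reg).atDatum (bd k (maxDomT M₁ Z))`,
whose (1.77) IS `fun177stdB (Node00.bgOfRecordB av reg) M₁ bd Z k` by `rfl` (`fun177std_atDatum`) — no twin of that lemma is needed.

HONESTY GUARD (director-ym №338 (5)).  PURELY ADDITIVE: the (b)-keyed parent stays landed and true on its own text; the proofs are the parent's verbatim over the lane's twin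
`B15Prop1ValueOfAnyMinimiserB.fun177stdB_bgOfRecordB_eq_wilsonAction4_of_isMinimizerB` and the carrier; no displayed premise of any consumer is deleted or weakened.

WHAT IS HERE.  §1 ★ `jointHolomorphic_fun177stdB_bgOfRecordB_of_minimiserFamily` ((J1) ⇐ (J0′) at node00-def-R's totalised bond-level map `Node00.bgOfRecordB av reg`, any class `reg`, any
bond-datum family `bd`) · §2 ★★ `jointHolomorphic_fun177stdB_bgMSCoPOfRecordB_of_minimiserFamily` (the same at the bond-level (2.12) datum of record `Node00.bgMSCoPOfRecordB F 2 ν K k Ω`, S2b).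

HONEST SCOPE.  One application of a landed holomorphy lemma after the value-of-any-minimiser junction; (J0′) is a HYPOTHESIS; nothing of [15] Thm 1 ∕ Prop. 9 asserted; count-neutral; N12
NOT discharged; K0⁷ ∕ K1⁹ NOT closed; one finite 𝕋⁴ programme at fixed ε — nothing continuum ∕ ℝ⁴ ∕ OS; the Yang–Mills mass gap (Clay) is NOT proved by any of this.

References: [B15] = [Balaban1989LargeFieldI] (1.74) p.192, (1.77) and Prop. 1 p.194; [Balaban1989LargeFieldII] p.359; [15] = [Balaban1985Variational] (2) p.278, Prop. 9 (190) p.309; [III] =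
[Balaban1988Convergent] (2.12) p.256, p.255; [II] = [Balaban1984PropagatorsII] (2.3) p.224.
-/

noncomputable section

open Set Metric
namespace Literature.MathematicalPhysics.QuantumFieldTheory.Balaban1983to89.B15Prop1JointHolomorphyFromMinimiserFamily

open T4Continuum B15DeterminingSets B15DeterminingSetsB GaugeField B15Prop1Carrier B8Eq17ClassAkV1 BlockAveraging
open B14.Eq22Determines (blockIter IsBlockUnion)
open Literature.MathematicalPhysics.QuantumFieldTheory.BalabanImbrieJaffe1984to88.BIJ85Eq453GaugeField (qsstarGIter0)
open B15Prop1JointHolomorphyFromBackground B15Prop1ValueOfAnyMinimiser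
open T4CubeChartGnomonic (SU2)
open scoped BigOperators

/-! ## §1  (J1) ⇐ (J0′) at node00-def-R's totalised bond-level solution map `Node00.bgOfRecordB av reg` -/

section OfRecordB
open B14.Eq213DetSet B15Sect1Instances B16Sect1Backgrounds
open B15Prop1AnalyticExtClause (cplxVec)
open B15Prop1ChartCalculusSU2 (E3)
open B15Prop1ChartSU2 (su2Chart)

variable {P : Params}

/-- ★ **(J1) FROM A HOLOMORPHIC FAMILY OF MINIMISERS, at the totalised BOND-LEVEL (2.12) solution map** `Node00.bgOfRecordB av reg` (any class `reg`) over a bond-datum family `bd`: if on the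
sup-ball of radius `R` there is ONE family `Ũ` of bond matrices with ℂ-differentiable entries bounded by `𝓐₀` which at every REAL point `(p, B′)` IS some `SU(2)` configuration `U′` that is a
MINIMAL CONFIGURATION of the (2.12) problem for the datum `M˙(Q_k^{s*}(exp(iB′)·ext(exp(ip)V_k)))` on the BONDS `bd k {Ω_j(Z)}` in `reg` — print's object `U_k(V′)` of [15] Prop. 9 (190)
along the chart, constrained à la [II] (2.3) — then print's function (1.77) `A(U_{k,Z}(·))` along the chart is the real trace of ONE ℂ-differentiable `𝒢` on that ball, `‖𝒢‖ ≤ |Plaq|·(1 +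
8𝓐₀⁴)`: the letter (J1).  One line: the minimiser carries the VALUE (1.77) (`fun177stdB_bgOfRecordB_eq_wilsonAction4_of_isMinimizerB`), then dag-n12-c's
`jointHolomorphic_fun177std_of_valueMatched` AT THE CARRIER `(bgOfRecordB av reg).atDatum (bd k (maxDomT M₁ Z))`; twin of `jointHolomorphic_fun177std_bgOfRecord_of_minimiserFamily`.
[cite: Balaban1989LargeFieldI, (1.74) p.192, (1.77) and Prop. 1 p.194; Balaban1989LargeFieldII, p.359; Balaban1985Variational, Prop. 9 (190) p.309; Balaban1988Convergent, (2.12) p.256; Balaban1984PropagatorsII, (2.3) p.224] -/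
theorem jointHolomorphic_fun177stdB_bgOfRecordB_of_minimiserFamily (av : ∀ j, Averaging P j SU2) (reg : Set (GaugeField P 0 SU2))
    (M₁ : ℕ) (bd : ℕ → (ℕ → Set (Site P 0)) → BDetSet P) (Z : Set (Site P 0)) (k : ℕ) (ext : GaugeField P k SU2 → GaugeField P k SU2)
    (Vk : GaugeField P k SU2) {R 𝓐₀ : ℝ}
    (hMin : ∃ Ũ : VecField P k (EuclideanSpace ℂ (Fin 3)) × VecField P k (EuclideanSpace ℂ (Fin 3)) → PBond P 0 → Matrix (Fin 2) (Fin 2) ℂ,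
      (∀ b a c, DifferentiableOn ℂ (fun z => Ũ z b a c) (ball 0 R)) ∧
      (∀ z ∈ ball (0 : VecField P k (EuclideanSpace ℂ (Fin 3)) × VecField P k (EuclideanSpace ℂ (Fin 3))) R, ∀ b a c, ‖Ũ z b a c‖ ≤ 𝓐₀) ∧
      ∀ p B' : VecField P k E3, ‖p‖ < R → ‖B'‖ < R → ∃ U' : GaugeField P 0 SU2,
        (∀ b, Ũ (cplxVec p, cplxVec B') b = ((U' b : SU2) : Matrix (Fin 2) (Fin 2) ℂ)) ∧
          IsMinimizerB av reg (bd k (maxDomT M₁ Z)) (avgFamily av (qsstarGIter0 k (expMul su2Chart B' (ext (expMul su2Chart p Vk))))) U') :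
    ∃ 𝒢 : VecField P k (EuclideanSpace ℂ (Fin 3)) × VecField P k (EuclideanSpace ℂ (Fin 3)) → ℂ,
      DifferentiableOn ℂ 𝒢 (ball 0 R) ∧
      (∀ z ∈ ball (0 : VecField P k (EuclideanSpace ℂ (Fin 3)) × VecField P k (EuclideanSpace ℂ (Fin 3))) R,
        ‖𝒢 z‖ ≤ (Fintype.card (Plaq P 0) : ℝ) * (1 + 8 * 𝓐₀ ^ 4)) ∧
      ∀ p B' : VecField P k E3, ‖p‖ < R → ‖B'‖ < R →
        𝒢 (cplxVec p, cplxVec B') = ((fun177stdB (Node00.bgOfRecordB av reg) M₁ bd Z k (expMul su2Chart B' (ext (expMul su2Chart p Vk))) : ℝ) : ℂ) := by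
  obtain ⟨Ũ, hdiff, hbd, hreal⟩ := hMin
  rw [← fun177std_atDatum]
  refine jointHolomorphic_fun177std_of_valueMatched ((Node00.bgOfRecordB av reg).atDatum (bd k (maxDomT M₁ Z))) M₁ Z k ext Vk
    ⟨Ũ, hdiff, hbd, fun p B' hp hB' => ?_⟩
  obtain ⟨U', hU', hmin⟩ := hreal p B' hp hB'
  refine ⟨U', hU', ?_⟩
  rw [fun177std_atDatum]
  exact (fun177stdB_bgOfRecordB_eq_wilsonAction4_of_isMinimizerB av reg M₁ bd Z k hmin).symm

end OfRecordB

/-! ## §2  (J1) ⇐ (J0′) at the bond-level (2.12) datum of record `Node00.bgMSCoPOfRecordB F 2 ν K k Ω` (S2b) -/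

section RecordB
open B14.Eq213DetSet B15Sect1Instances B16Sect1Backgrounds
open B15Prop1AnalyticExtClause (cplxVec)
open B15Prop1ChartCalculusSU2 (E3)
open B15Prop1ChartSU2 (su2Chart)

variable {F : T4Family}

/-- ★★ **(J1) FROM A HOLOMORPHIC FAMILY OF MINIMISERS, at the BOND-LEVEL (2.12) datum of record** `Node00.bgMSCoPOfRecordB F 2 ν K k Ω` (the class `regMSCoPOfRecord F 2 ν K k Ω` = [15] (2) on
the support of record, print's class unchanged; the solution map on the bonds of a family `bd`, print's [II] (2.3) datum at `bd := lamDatumP`): the form in which the re-keyed N12 endpoints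
read the letter; twin of `jointHolomorphic_fun177std_bgMSCoPOfRecord_of_minimiserFamily`.
[cite: Balaban1989LargeFieldI, (1.74) p.192, (1.77) and Prop. 1 p.194; Balaban1989LargeFieldII, p.359; Balaban1985Variational, (2) p.278, Prop. 9 (190) p.309; Balaban1988Convergent, (2.12) p.256, p.255; Balaban1984PropagatorsII, (2.3) p.224] -/
theorem jointHolomorphic_fun177stdB_bgMSCoPOfRecordB_of_minimiserFamily (ν : Node00.Stage7Numerics) (K k : ℕ) (Ω : ℕ → Set (Site (F.P K) 0))
    (M₁ : ℕ) (bd : ℕ → (ℕ → Set (Site (F.P K) 0)) → BDetSet (F.P K)) (Z : Set (Site (F.P K) 0)) (k' : ℕ)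
    (ext : GaugeField (F.P K) k' SU2 → GaugeField (F.P K) k' SU2) (Vk : GaugeField (F.P K) k' SU2) {R 𝓐₀ : ℝ}
    (hMin : ∃ Ũ : VecField (F.P K) k' (EuclideanSpace ℂ (Fin 3)) × VecField (F.P K) k' (EuclideanSpace ℂ (Fin 3)) →
        PBond (F.P K) 0 → Matrix (Fin 2) (Fin 2) ℂ,
      (∀ b a c, DifferentiableOn ℂ (fun z => Ũ z b a c) (ball 0 R)) ∧
      (∀ z ∈ ball (0 : VecField (F.P K) k' (EuclideanSpace ℂ (Fin 3)) × VecField (F.P K) k' (EuclideanSpace ℂ (Fin 3))) R,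
        ∀ b a c, ‖Ũ z b a c‖ ≤ 𝓐₀) ∧
      ∀ p B' : VecField (F.P K) k' E3, ‖p‖ < R → ‖B'‖ < R → ∃ U' : GaugeField (F.P K) 0 SU2,
        (∀ b, Ũ (cplxVec p, cplxVec B') b = ((U' b : SU2) : Matrix (Fin 2) (Fin 2) ℂ)) ∧
          IsMinimizerB (Node00.avOfRecord F 2 K) (Node00.regMSCoPOfRecord F 2 ν K k Ω) (bd k' (maxDomT M₁ Z))
            (avgFamily (Node00.avOfRecord F 2 K) (qsstarGIter0 k' (expMul su2Chart B' (ext (expMul su2Chart p Vk))))) U') :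
    ∃ 𝒢 : VecField (F.P K) k' (EuclideanSpace ℂ (Fin 3)) × VecField (F.P K) k' (EuclideanSpace ℂ (Fin 3)) → ℂ,
      DifferentiableOn ℂ 𝒢 (ball 0 R) ∧
      (∀ z ∈ ball (0 : VecField (F.P K) k' (EuclideanSpace ℂ (Fin 3)) × VecField (F.P K) k' (EuclideanSpace ℂ (Fin 3))) R,
        ‖𝒢 z‖ ≤ (Fintype.card (Plaq (F.P K) 0) : ℝ) * (1 + 8 * 𝓐₀ ^ 4)) ∧
      ∀ p B' : VecField (F.P K) k' E3, ‖p‖ < R → ‖B'‖ < R →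
        𝒢 (cplxVec p, cplxVec B') =
          ((fun177stdB (Node00.bgMSCoPOfRecordB F 2 ν K k Ω) M₁ bd Z k' (expMul su2Chart B' (ext (expMul su2Chart p Vk))) : ℝ) : ℂ) :=
  jointHolomorphic_fun177stdB_bgOfRecordB_of_minimiserFamily (Node00.avOfRecord F 2 K) (Node00.regMSCoPOfRecord F 2 ν K k Ω) M₁ bd Z k' ext Vk hMin

end RecordB

end Literature.MathematicalPhysics.QuantumFieldTheory.Balaban1983to89.B15Prop1JointHolomorphyFromMinimiserFamily

end
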